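import Mathlib.Data.List.Infix
import Literature.Computability.Cryptography.EditDistFacts
import HarnessLib

/-!
# Sellers' algorithm: the dynamic-programming search for a pattern in a text allowing errors

Navarro's survey [Navarro2001] states the approximate string matching problem (§3): given a text
`T`, a pattern `P`, an error bound `k` and the edit distance `ed`, *return the set of all text
positions `j` such that there exists `i` with `ed(P, T_{i..j}) ≤ k`* (end points of approximate
occurrences).  §5.1.1 recalls the dynamic-programming matrix `C_{i,j} = ed(x_{1..i}, y_{1..j})`
(our `editDist`, defined in `Literature.Computability.Cryptography.SequenceProblems` by exactly
that recurrence, read on the heads of the lists) and two of its properties "which can be easily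
proved by induction (see, e.g. [Ukk85a])": *neighboring cells differ in at most one* (in the tree:
`editDist_cons_left_le`, `editDist_le_cons_left`, `editDist_cons_right_le`,
`editDist_le_cons_right`) and *upper-left to lower-right diagonals are nondecreasing*
(`editDist_le_editDist_cons_cons` below, with `editDist_cons_cons_le` of the tree: the step along
a diagonal is `0` or `1`).  §5.1.2 is **Sellers' algorithm** [Sellers1980]: the same recurrence
with the first row set to `C_{0,j} = 0` ("the empty pattern matches with zero errors at any text
position, because it matches with a text substring of length zero"), after which *the text
positions where `C_{m,j} ≤ k` are reported*.

This file formalises §5.1.2 and proves what the survey asserts about it: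

* `sellers P T i j` — the matrix of §5.1.2, literally: `C_{0,j} = 0`, `C_{i,0} = i`,
  `C_{i,j} = min (C_{i-1,j} + 1, C_{i,j-1} + 1, C_{i-1,j-1} + δ(P_i, T_j))`.
* `sellers_le_editDist_of_suffix`, `exists_suffix_sellers_eq_editDist` — **correctness**: for
  `i ≤ |P|`, `j ≤ |T|`, `C_{i,j}` is the minimum of `ed(P_{1..i}, T_{i'+1..j})` over the suffixes
  `T_{i'+1..j}` of `T_{1..j}`; hence `sellers_length_le_iff`: `C_{m,j} ≤ k` iff position `j` is
  the end point of an approximate occurrence, i.e. iff `∃ i' ≤ j, ed(P, T_{i'+1..j}) ≤ k` — the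
  reported positions are exactly the answer to the problem of §3.
* `sellers_update` — the column update formula of §5.1.2 as printed
  (`C'_i = if P_i = T_j then C_{i-1} else 1 + min (C'_{i-1}, C_i, C_{i-1})`), equivalent to the
  `min`/`δ` recurrence because neighbouring cells differ by at most one
  (`prefixEditDist_le_cons_right`, `prefixEditDist_le_cons_left`, `prefixEditDist_cons_cons_same`).
* `prefixEditDist x y` — the same recurrence read on the heads of the lists (as `editDist` is in
  this library): the least edit distance from `x` to a *prefix* of `y`; `sellers` is
  `prefixEditDist` of the reversed prefixes (`sellers_eq_prefixEditDist`), which is how the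
  correctness proof goes ("by reversing all strings we can obtain start points", §3):
  `prefixEditDist_le_iff` characterises the *start* points of approximate occurrences.
* `editDist_le_editDist_cons_cons` — the diagonal property of §5.1.1.

## References

* G. Navarro, *A guided tour to approximate string matching*, ACM Computing Surveys 33 (2001)
  31–88, §3 (problem statement), §5.1.1 (the matrix and its properties), §5.1.2 (text searching:
  Sellers' algorithm). [Navarro2001]
* P. H. Sellers, *The theory and computation of evolutionary distances: pattern recognition*,
  J. Algorithms 1 (1980) 359–373 — the search version of the recurrence, as attributed in
  [Navarro2001, §5.1 and §5.1.2]. [Sellers1980]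
* E. Ukkonen, *Algorithms for approximate string matching*, Inform. Control 64 (1985) — the matrix
  properties, as attributed in [Navarro2001, §5.1.1] (`[Ukk85a]`).
-/

namespace Literature.Computability.StringMatching

open Literature.Computability.Cryptography

variable {α : Type*} [DecidableEq α]

/-! ### The diagonal property of the edit-distance matrix (Navarro §5.1.1) -/

/-- **Diagonals of the edit-distance matrix are nondecreasing** (Navarro 2001, §5.1.1, citing
Ukkonen 1985): `C_{i-1,j-1} ≤ C_{i,j}`, i.e. `editDist x y ≤ editDist (a :: x) (b :: y)`; together
with `editDist_cons_cons_le` the step along a diagonal is `0` or `1`.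
[cite: Navarro2001, §5.1.1] -/
theorem editDist_le_editDist_cons_cons (a b : α) (x y : List α) :
    editDist x y ≤ editDist (a :: x) (b :: y) := by
  rw [editDist_cons_cons]
  have h1 := editDist_le_cons_right b x y
  have h2 := editDist_le_cons_left a x y
  split_ifs <;> omega

/-- The diagonal step is `0` or `1` (Navarro 2001, §5.1.1): `C_{i,j} - C_{i-1,j-1} ∈ {0, 1}`.
[cite: Navarro2001, §5.1.1] -/
theorem editDist_cons_cons_sub_mem (a b : α) (x y : List α) :
    editDist (a :: x) (b :: y) - editDist x y ∈ ({0, 1} : Set ℕ) := by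
  have h1 := editDist_le_editDist_cons_cons a b x y
  have h2 := editDist_cons_cons_le a b x y
  rcases Nat.eq_or_lt_of_le h2 with h | h
  · right; simp only [Set.mem_singleton_iff]; omega
  · left; show _ = 0; omega

/-! ### The search recurrence on the heads of the lists: least distance to a prefix -/

/-- `prefixEditDist x y`: Sellers' recurrence read on the heads of the lists — the recursion of
`editDist` with the base case `prefixEditDist [] y = 0` ("the empty pattern matches with zero
errors at any text position", Navarro 2001, §5.1.2).  It is the least `editDist x y'` over the
prefixes `y'` of `y` (`prefixEditDist_le_editDist_of_prefix`, `exists_prefix_prefixEditDist_eq`).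
[cite: Navarro2001, §5.1.2] -/
def prefixEditDist : List α → List α → ℕ
  | [], _ => 0
  | x :: xs, [] => (x :: xs).length
  | x :: xs, y :: ys =>
      min (prefixEditDist xs (y :: ys) + 1)
        (min (prefixEditDist (x :: xs) ys + 1)
          (prefixEditDist xs ys + if x = y then 0 else 1))
termination_by xs ys => xs.length + ys.length

/-- `C_{0,j} = 0`. [cite: Navarro2001, §5.1.2] -/
@[simp] theorem prefixEditDist_nil_left (y : List α) : prefixEditDist ([] : List α) y = 0 := by
  cases y <;> simp [prefixEditDist]

/-- `C_{i,0} = i`. [cite: Navarro2001, §5.1.2] -/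
@[simp] theorem prefixEditDist_nil_right (x : List α) : prefixEditDist x [] = x.length := by
  cases x <;> simp [prefixEditDist]

/-- The recurrence on two nonempty lists. [cite: Navarro2001, §5.1.2] -/
theorem prefixEditDist_cons_cons (a b : α) (x y : List α) :
    prefixEditDist (a :: x) (b :: y) =
      min (prefixEditDist x (b :: y) + 1)
        (min (prefixEditDist (a :: x) y + 1) (prefixEditDist x y + if a = b then 0 else 1)) := by
  simp [prefixEditDist]

/-- `prefixEditDist x y ≤ |x|` (delete all of `x`: the empty prefix of `y`). [folklore] -/
private theorem prefixEditDist_le_length (x y : List α) : prefixEditDist x y ≤ x.length := by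
  induction x generalizing y with
  | nil => simp
  | cons a x ih =>
      cases y with
      | nil => simp
      | cons b y =>
          rw [prefixEditDist_cons_cons]
          have := ih (b :: y)
          simp only [List.length_cons]
          omega

/-- **Lower bound**: `prefixEditDist x y ≤ editDist x y'` for every prefix `y'` of `y`
(Navarro 2001, §5.1.2: the search matrix is below the distance to every candidate substring).
[cite: Navarro2001, §5.1.2] -/
theorem prefixEditDist_le_editDist_of_prefix :
    ∀ (x y y' : List α), y' <+: y → prefixEditDist x y ≤ editDist x y'
  | [], y, y', _ => by simp
  | a :: x, [], y', h => by
      obtain rfl := List.prefix_nil.mp h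
      simp
  | a :: x, b :: y, y', h => by
      rcases y' with _ | ⟨c, y'⟩
      · simpa using prefixEditDist_le_length (a :: x) (b :: y)
      · obtain ⟨rfl, h'⟩ := List.cons_prefix_cons.mp h
        rw [prefixEditDist_cons_cons, editDist_cons_cons]
        have h1 := prefixEditDist_le_editDist_of_prefix x (c :: y) (c :: y')
          (List.cons_prefix_cons.mpr ⟨rfl, h'⟩)
        have h2 := prefixEditDist_le_editDist_of_prefix (a :: x) y y' h'
        have h3 := prefixEditDist_le_editDist_of_prefix x y y' h'
        split_ifs <;> omega

/-- **Attained**: some prefix `y'` of `y` has `editDist x y' ≤ prefixEditDist x y` (follow the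
minimising branch of the recurrence). [cite: Navarro2001, §5.1.2] -/
theorem exists_prefix_editDist_le_prefixEditDist :
    ∀ (x y : List α), ∃ y', y' <+: y ∧ editDist x y' ≤ prefixEditDist x y
  | [], y => ⟨[], List.nil_prefix, by simp⟩
  | a :: x, [] => ⟨[], List.nil_prefix, by simp⟩
  | a :: x, b :: y => by
      obtain ⟨y₁, hy₁, e₁⟩ := exists_prefix_editDist_le_prefixEditDist x (b :: y)
      obtain ⟨y₂, hy₂, e₂⟩ := exists_prefix_editDist_le_prefixEditDist (a :: x) y
      obtain ⟨y₃, hy₃, e₃⟩ := exists_prefix_editDist_le_prefixEditDist x y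
      rw [prefixEditDist_cons_cons]
      -- the three branches: delete `a` (keep `y₁`), insert `b` (prefix `b :: y₂`),
      -- substitute / match (prefix `b :: y₃`)
      rcases le_total (prefixEditDist x (b :: y) + 1)
          (min (prefixEditDist (a :: x) y + 1) (prefixEditDist x y + if a = b then 0 else 1))
        with h | h
      · refine ⟨y₁, hy₁, ?_⟩
        rw [min_eq_left h]
        have := editDist_cons_left_le a x y₁
        omega
      · rw [min_eq_right h]
        rcases le_total (prefixEditDist (a :: x) y + 1)
            (prefixEditDist x y + if a = b then 0 else 1) with h' | h'
        · refine ⟨b :: y₂, List.cons_prefix_cons.mpr ⟨rfl, hy₂⟩, ?_⟩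
          rw [min_eq_left h']
          have := editDist_cons_right_le b (a :: x) y₂
          omega
        · refine ⟨b :: y₃, List.cons_prefix_cons.mpr ⟨rfl, hy₃⟩, ?_⟩
          rw [min_eq_right h', editDist_cons_cons]
          split_ifs with hab
          · have := min_le_right (editDist x (b :: y₃) + 1)
              (min (editDist (a :: x) y₃ + 1) (editDist x y₃ + 0))
            have := min_le_right (editDist (a :: x) y₃ + 1) (editDist x y₃ + 0)
            omega
          · have := min_le_right (editDist x (b :: y₃) + 1)
              (min (editDist (a :: x) y₃ + 1) (editDist x y₃ + 1))
            have := min_le_right (editDist (a :: x) y₃ + 1) (editDist x y₃ + 1)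
            omega

/-- `prefixEditDist x y` **is** the least distance from `x` to a prefix of `y`: it is attained.
[cite: Navarro2001, §5.1.2] -/
theorem exists_prefix_prefixEditDist_eq (x y : List α) :
    ∃ y', y' <+: y ∧ prefixEditDist x y = editDist x y' := by
  obtain ⟨y', hy', e⟩ := exists_prefix_editDist_le_prefixEditDist x y
  exact ⟨y', hy', le_antisymm (prefixEditDist_le_editDist_of_prefix x y y' hy') e⟩

/-- **Start points of approximate occurrences** ("by reversing all strings we can obtain start
points", Navarro 2001, §3): `prefixEditDist P S ≤ k` iff some prefix of `S` is within edit
distance `k` of `P`; with `S = T.drop i` this says that an approximate occurrence of `P` starts at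
text position `i`. [cite: Navarro2001, §3 and §5.1.2] -/
theorem prefixEditDist_le_iff (x y : List α) (k : ℕ) :
    prefixEditDist x y ≤ k ↔ ∃ y', y' <+: y ∧ editDist x y' ≤ k := by
  constructor
  · intro h
    obtain ⟨y', hy', e⟩ := exists_prefix_prefixEditDist_eq x y
    exact ⟨y', hy', e ▸ h⟩
  · rintro ⟨y', hy', e⟩
    exact (prefixEditDist_le_editDist_of_prefix x y y' hy').trans e

/-- Neighbouring cells of the search matrix differ by at most one, text direction:
`prefixEditDist x y ≤ prefixEditDist x (b :: y) + 1` (Navarro 2001, §5.1.1–§5.1.2: "both formulas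
are equivalent because neighboring cells differ in at most one"). [cite: Navarro2001, §5.1.1] -/
theorem prefixEditDist_le_cons_right (b : α) (x y : List α) :
    prefixEditDist x y ≤ prefixEditDist x (b :: y) + 1 := by
  obtain ⟨y', hy', e⟩ := exists_prefix_prefixEditDist_eq x (b :: y)
  rw [e]
  rcases y' with _ | ⟨c, y'⟩
  · have := prefixEditDist_le_length x y
    simp only [editDist_nil_right]
    omega
  · obtain ⟨rfl, h'⟩ := List.cons_prefix_cons.mp hy'
    exact (prefixEditDist_le_editDist_of_prefix x y y' h').trans (editDist_le_cons_right c x y')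

/-- Neighbouring cells of the search matrix differ by at most one, pattern direction:
`prefixEditDist x y ≤ prefixEditDist (a :: x) y + 1`. [cite: Navarro2001, §5.1.1] -/
theorem prefixEditDist_le_cons_left (a : α) (x y : List α) :
    prefixEditDist x y ≤ prefixEditDist (a :: x) y + 1 := by
  obtain ⟨y', hy', e⟩ := exists_prefix_prefixEditDist_eq (a :: x) y
  rw [e]
  exact (prefixEditDist_le_editDist_of_prefix x y y' hy').trans (editDist_le_cons_left a x y')

/-- Equal heads are matched for free: `prefixEditDist (a :: x) (a :: y) = prefixEditDist x y` — the
`if P_i = T_j then C_{i-1}` branch of the update formula of §5.1.2. [cite: Navarro2001, §5.1.2] -/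
theorem prefixEditDist_cons_cons_same (a : α) (x y : List α) :
    prefixEditDist (a :: x) (a :: y) = prefixEditDist x y := by
  rw [prefixEditDist_cons_cons, if_pos rfl]
  have h1 := prefixEditDist_le_cons_right a x y
  have h2 := prefixEditDist_le_cons_left a x y
  omega

/-! ### Sellers' matrix, literally (Navarro §5.1.2) -/

/-- **Sellers' search matrix** (Navarro 2001, §5.1.2; Sellers 1980): for a pattern `P = p₁⋯p_m`
and a text `T = t₁⋯t_n`, `C_{0,j} = 0`, `C_{i,0} = i` and
`C_{i,j} = min (C_{i-1,j} + 1, C_{i,j-1} + 1, C_{i-1,j-1} + δ(p_i, t_j))` with `δ(a,b) = 0` if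
`a = b` and `1` otherwise (indices of `P`, `T` are `0`-based below: `p_i = P[i-1]`).
[cite: Navarro2001, §5.1.2] -/
def sellers (P T : List α) : ℕ → ℕ → ℕ
  | 0, _ => 0
  | i + 1, 0 => i + 1
  | i + 1, j + 1 =>
      min (sellers P T i (j + 1) + 1)
        (min (sellers P T (i + 1) j + 1)
          (sellers P T i j + if P[i]? = T[j]? then 0 else 1))
termination_by i j => i + j

/-- `C_{0,j} = 0`. [cite: Navarro2001, §5.1.2] -/
@[simp] theorem sellers_zero_left (P T : List α) (j : ℕ) : sellers P T 0 j = 0 := by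
  cases j <;> simp [sellers]

/-- `C_{i,0} = i`. [cite: Navarro2001, §5.1.2] -/
@[simp] theorem sellers_zero_right (P T : List α) (i : ℕ) : sellers P T i 0 = i := by
  cases i <;> simp [sellers]

/-- The recurrence. [cite: Navarro2001, §5.1.2] -/
theorem sellers_succ_succ (P T : List α) (i j : ℕ) :
    sellers P T (i + 1) (j + 1) =
      min (sellers P T i (j + 1) + 1)
        (min (sellers P T (i + 1) j + 1) (sellers P T i j + if P[i]? = T[j]? then 0 else 1)) := by
  simp [sellers]

omit [DecidableEq α] in
/-- Reversed prefixes grow at the head: `(l.take (n+1)).reverse = l[n] :: (l.take n).reverse`.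
[folklore] -/
private theorem reverse_take_succ (l : List α) {n : ℕ} (hn : n < l.length) :
    (l.take (n + 1)).reverse = l[n] :: (l.take n).reverse := by
  rw [List.take_add_one, List.getElem?_eq_getElem hn, Option.toList_some, List.reverse_append,
    List.reverse_singleton, List.singleton_append]

/-- **The matrix is the head recurrence on reversed prefixes**: for `i ≤ |P|` and `j ≤ |T|`,
`C_{i,j} = prefixEditDist (P_{1..i})ʳ (T_{1..j})ʳ`. [cite: Navarro2001, §5.1.2] -/
theorem sellers_eq_prefixEditDist (P T : List α) :
    ∀ {i j : ℕ}, i ≤ P.length → j ≤ T.length →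
      sellers P T i j = prefixEditDist (P.take i).reverse (T.take j).reverse
  | 0, j, _, _ => by simp
  | i + 1, 0, hi, _ => by
      simp only [sellers_zero_right, List.take_zero, List.reverse_nil, prefixEditDist_nil_right,
        List.length_reverse, List.length_take]
      omega
  | i + 1, j + 1, hi, hj => by
      have hi' : i < P.length := by omega
      have hj' : j < T.length := by omega
      rw [sellers_succ_succ, sellers_eq_prefixEditDist P T (Nat.le_of_succ_le hi) hj,
        sellers_eq_prefixEditDist P T hi (Nat.le_of_succ_le hj),
        sellers_eq_prefixEditDist P T (Nat.le_of_succ_le hi) (Nat.le_of_succ_le hj),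
        reverse_take_succ P hi', reverse_take_succ T hj', prefixEditDist_cons_cons,
        List.getElem?_eq_getElem hi', List.getElem?_eq_getElem hj']
      simp only [Option.some.injEq]

/-- **Navarro's column update formula** (2001, §5.1.2), literally: processing text character
`T_j`, the new column is `C'_i = if P_i = T_j then C_{i-1} else 1 + min (C'_{i-1}, C_i, C_{i-1})`
(here `C = sellers P T · j`, `C' = sellers P T · (j+1)`, `0`-based letters `P[i]`, `T[j]`); it
agrees with the `min`/`δ` recurrence because neighbouring cells differ by at most one.
[cite: Navarro2001, §5.1.2] -/
theorem sellers_update (P T : List α) {i j : ℕ} (hi : i < P.length) (hj : j < T.length) :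
    sellers P T (i + 1) (j + 1) =
      if P[i] = T[j] then sellers P T i j
      else 1 + min (sellers P T i (j + 1)) (min (sellers P T (i + 1) j) (sellers P T i j)) := by
  rw [sellers_succ_succ, List.getElem?_eq_getElem hi, List.getElem?_eq_getElem hj]
  simp only [Option.some.injEq]
  split_ifs with h
  · have h1 : sellers P T i j ≤ sellers P T i (j + 1) + 1 := by
      rw [sellers_eq_prefixEditDist P T hi.le hj, sellers_eq_prefixEditDist P T hi.le hj.le,
        reverse_take_succ T hj]
      exact prefixEditDist_le_cons_right _ _ _
    have h2 : sellers P T i j ≤ sellers P T (i + 1) j + 1 := by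
      rw [sellers_eq_prefixEditDist P T hi hj.le, sellers_eq_prefixEditDist P T hi.le hj.le,
        reverse_take_succ P hi]
      exact prefixEditDist_le_cons_left _ _ _
    omega
  · omega

omit [DecidableEq α] in
/-- Suffixes of a list are its `drop`s. [folklore] -/
private theorem suffix_iff_exists_drop (s l : List α) :
    s <:+ l ↔ ∃ i, i ≤ l.length ∧ s = l.drop i := by
  constructor
  · rintro ⟨t, rfl⟩
    exact ⟨t.length, by simp, by simp⟩
  · rintro ⟨i, -, rfl⟩
    exact List.drop_suffix i l

/-- **Correctness of Sellers' algorithm, lower bound** (Navarro 2001, §5.1.2): for `i ≤ |P|`,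
`j ≤ |T|` and every suffix `S = T_{i'+1..j}` of `T_{1..j}`, `C_{i,j} ≤ ed(P_{1..i}, S)`.
[cite: Navarro2001, §5.1.2] -/
theorem sellers_le_editDist_of_suffix (P T : List α) {i j : ℕ} (hi : i ≤ P.length)
    (hj : j ≤ T.length) (S : List α) (hS : S <:+ T.take j) :
    sellers P T i j ≤ editDist (P.take i) S := by
  rw [sellers_eq_prefixEditDist P T hi hj, ← editDist_reverse]
  exact prefixEditDist_le_editDist_of_prefix _ _ _ (List.reverse_prefix.mpr hS)

/-- **Correctness of Sellers' algorithm, attained** (Navarro 2001, §5.1.2): for `i ≤ |P|`,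
`j ≤ |T|` there is a suffix `S = T_{i'+1..j}` of `T_{1..j}` with `C_{i,j} = ed(P_{1..i}, S)`; with
the lower bound, `C_{i,j} = min_{i'} ed(P_{1..i}, T_{i'+1..j})`. [cite: Navarro2001, §5.1.2] -/
theorem exists_suffix_sellers_eq_editDist (P T : List α) {i j : ℕ} (hi : i ≤ P.length)
    (hj : j ≤ T.length) :
    ∃ S, S <:+ T.take j ∧ sellers P T i j = editDist (P.take i) S := by
  obtain ⟨y', hy', e⟩ := exists_prefix_prefixEditDist_eq (P.take i).reverse (T.take j).reverse
  refine ⟨y'.reverse, List.reverse_prefix.mp (by simpa using hy'), ?_⟩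
  rw [sellers_eq_prefixEditDist P T hi hj, e, ← editDist_reverse, List.reverse_reverse]

/-- The same with the substring written as `T_{i'+1..j} = (T.take j).drop i'`, `i' ≤ j`.
[cite: Navarro2001, §5.1.2] -/
theorem exists_sellers_eq_editDist_drop (P T : List α) {i j : ℕ} (hi : i ≤ P.length)
    (hj : j ≤ T.length) :
    ∃ i', i' ≤ j ∧ sellers P T i j = editDist (P.take i) ((T.take j).drop i') := by
  obtain ⟨S, hS, e⟩ := exists_suffix_sellers_eq_editDist P T hi hj
  obtain ⟨i', hi', rfl⟩ := (suffix_iff_exists_drop S (T.take j)).mp hS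
  exact ⟨i', by simpa [Nat.min_eq_left hj] using hi', e⟩

/-- **The reported positions solve the problem of §3** (Navarro 2001, §5.1.2: "the text positions
where `C_m ≤ k` are reported"; §3: "return the set of all the text positions `j` such that there
exists `i` such that `d(P, T_{i..j}) ≤ k`"): for `j ≤ |T|`, `C_{m,j} ≤ k` iff some substring of `T`
ending at position `j` is within edit distance `k` of `P`. [cite: Navarro2001, §3 and §5.1.2] -/
theorem sellers_length_le_iff (P T : List α) {j : ℕ} (hj : j ≤ T.length) (k : ℕ) :
    sellers P T P.length j ≤ k ↔ ∃ i, i ≤ j ∧ editDist P ((T.take j).drop i) ≤ k := by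
  constructor
  · intro h
    obtain ⟨i, hi, e⟩ := exists_sellers_eq_editDist_drop P T le_rfl hj
    rw [e, List.take_length] at h
    exact ⟨i, hi, h⟩
  · rintro ⟨i, hi, e⟩
    have := sellers_le_editDist_of_suffix P T le_rfl hj ((T.take j).drop i) (List.drop_suffix _ _)
    rw [List.take_length] at this
    exact this.trans e

/-- A worked instance of the recurrence (letters coded `0, 1`): searching the pattern `01` in the
text `101`, the last row of Sellers' matrix reads `C_{2,0..3} = 2, 1, 1, 0` — with `k = 0` exactly
position `3` is reported (the exact occurrence `t₂t₃ = 01`), with `k = 1` positions `1, 2, 3`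
(cf. the `survey`/`surgery` example of Navarro 2001, §5.1.2, Fig. 9). [cite: Navarro2001, §5.1.2] -/
example :
    sellers [0, 1] [1, 0, 1] 2 0 = 2 ∧ sellers [0, 1] [1, 0, 1] 2 1 = 1 ∧
      sellers [0, 1] [1, 0, 1] 2 2 = 1 ∧ sellers [0, 1] [1, 0, 1] 2 3 = 0 := by
  simp [sellers_succ_succ]

end Literature.Computability.StringMatching
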